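import Summits.NavierStokesRegularity.FunctionalMining.StretchingLaminateStatE
import Summits.NavierStokesRegularity.FunctionalMining.StretchingConfinementLemma
import HarnessLib

/-!
# K1-Q1 laminate step, part 9: the three ESTIMATES with constants — for every fast scale `m ≥ 1`

Cell `pub-nsfunc` (host summit NavierStokesRegularity, topic `FunctionalMining`), prove seat gen 6, for the
`LaminateStep` node (dict BLUEPRINT §2–§3, the `O(1/m)` bookkeeping). **Search for candidate a priori estimates;
no regularity claim.** Static smooth fields on `T³`.

`LamData.estimates`: for fixed construction data (in particular a fixed ramp width `ε`) there are constants
`K, C ≥ 0` such that for every `m ≥ 1` the potential `A = Atot m` satisfies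
* the ceiling `|ω(G + ∇curl A(x))|² ≤ max B₊ B₋ + 24ρ′(β′+ρ′)` with `ρ′ = 2εβ_M + K/m`,
* the production estimate with remainder `162(K/m)(β_Z + K/m)² + C/m + ε·C₁ᴾ`,
* the enstrophy estimate with remainder `9(K/m)(β_Z + K/m) + C/m + ε·C₁ᴱ`.
`K` collects the sup norms of `∇E±, ∇²E±, A±, ∇A±` (tree remainder bound), `C` the ten two-scale constants
(`Confinement.two_scale`).
-/

noncomputable section

open MeasureTheory Set Filter Topology Function
open scoped ContDiff

namespace Summit.NavierStokesRegularity.FunctionalMining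

open Literature.Analysis Literature.Analysis.FunctionSpaces Literature.Analysis.FunctionSpaces.Torus
open Literature.Analysis.FluidPDE Literature.Analysis.FluidPDE.Torus
open LaminateWindow LaminateDirection WrapStretching Confinement Laminate

namespace LamData

variable (D : LamData)

/-- **Sup norms of a confined child**: constants `K ≥ 0` with the tree remainder bound
`|∇curl(E•A_m)(x) − E(x)·∇curl A(m•x)| ≤ K/m` for all `m ≥ 1`. [ours] -/
theorem exists_remainder_const {E : UnitAddTorus (Fin 3) → ℝ} {A : UnitAddTorus (Fin 3) → EuclideanSpace ℝ (Fin 3)}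
    (hE : IsSmooth E) (hA : IsSmooth A) :
    ∃ K : ℝ, 0 ≤ K ∧ ∀ m : ℕ, 1 ≤ m → ∀ x i j,
      |gradAt (curlField (confine E (rescale A m))) x i j - E x * gradAt (curlField A) (m • x) i j| ≤ K / m := by
  obtain ⟨L₁, hL₁, hE1⟩ := exists_forall₂_abs_le (f := fun a x => Torus.partialDeriv a E x)
    fun a => (hE.partialDeriv a).continuous
  obtain ⟨L₂, hL₂, hE2⟩ := exists_forall₃_abs_le (f := fun j a x => Torus.partialDeriv j (Torus.partialDeriv a E) x)
    fun j a => ((hE.partialDeriv a).partialDeriv j).continuous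
  obtain ⟨a₀, ha₀, hA0'⟩ := exists_forall₂_abs_le (f := fun b x => A x b) fun b => (hA.apply b).continuous
  obtain ⟨a₁, ha₁, hA1'⟩ := exists_forall₃_abs_le (f := fun j b x => Torus.partialDeriv j A x b)
    fun j b => ((hA.partialDeriv j).apply b).continuous
  refine ⟨2 * L₂ * a₀ + 4 * L₁ * a₁, by positivity, fun m hm x i j => ?_⟩
  exact abs_gradAt_curl_confine_sub_le hE hA hE1 hE2 (fun x b => hA0' b x) (fun j x b => hA1' j b x) hm x i j

/-- A two-scale constant in the `C/m` form (`m ≥ 1`). [ours; bookkeeping] -/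
theorem exists_two_scale_const {b H : UnitAddTorus (Fin 3) → ℝ} (hb : IsSmooth b) (hH : IsSmooth H) :
    ∃ C : ℝ, 0 ≤ C ∧ ∀ m : ℕ, 1 ≤ m → |(∫ x, b x * H (m • x)) - (∫ x, b x) * ∫ x, H x| ≤ C / m := by
  obtain ⟨C, hC, h⟩ := two_scale hb hH
  refine ⟨C, hC, fun m hm => (h m hm).trans ?_⟩
  have hmr : (1 : ℝ) ≤ m := by exact_mod_cast hm
  exact div_le_div_of_nonneg_left hC (by linarith) (by nlinarith)

/-- **THE THREE ESTIMATES WITH CONSTANTS.** [ours] -/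
theorem estimates (G : Fin 3 → Fin 3 → ℝ) {Bp Bm βG βM βX : ℝ}
    (hβG : ∀ i j, |G i j| ≤ βG) (hβM : ∀ i j, |D.M i j| ≤ βM)
    (hβXp : ∀ y i j, |D.XP y i j| ≤ βX) (hβXm : ∀ y i j, |D.XM y i j| ≤ βX)
    (hGp : vortSqM (D.Gp G) ≤ Bp) (hGm : vortSqM (D.Gm G) ≤ Bm)
    (hVp : ∀ y, vortSqM (D.Gp G + D.XP y) ≤ Bp) (hVm : ∀ y, vortSqM (D.Gm G + D.XM y) ≤ Bm) :
    ∃ K C : ℝ, 0 ≤ K ∧ 0 ≤ C ∧ ∀ m : ℕ, 1 ≤ m →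
      (∀ x, vortSqM (D.T G m x) ≤ max Bp Bm +
        24 * (2 * D.q.eps * βM + K / m) * ((βG + βM + βX) + (2 * D.q.eps * βM + K / m))) ∧
      |(∫ x, prodBC (D.T G m x)) -
          (D.q.lam * (∫ y, prodBC (D.Gp G + D.XP y)) + (1 - D.q.lam) * ∫ y, prodBC (D.Gm G + D.XM y))| ≤
        162 * (K / m) * ((βG + βM + 2 * βX) + K / m) ^ 2 + C / m + D.q.eps * statPConst βG βM βX ∧
      |(∫ x, halfSqM (D.T G m x)) -
          (D.q.lam * (∫ y, halfSqM (D.Gp G + D.XP y)) + (1 - D.q.lam) * ∫ y, halfSqM (D.Gm G + D.XM y))| ≤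
        9 * (K / m) * ((βG + βM + 2 * βX) + K / m) + C / m + D.q.eps * statEConst βG βM βX := by
  have hFp := isSmooth_curlField D.hAp
  have hFm := isSmooth_curlField D.hAm
  -- remainder constants of the two children
  obtain ⟨Kp, hKp, hRp⟩ := exists_remainder_const D.isSmooth_EP D.hAp
  obtain ⟨Km, hKm, hRm⟩ := exists_remainder_const D.isSmooth_EM D.hAm
  -- the ten two-scale constants
  have hP1s := D.isSmooth_EP
  have hP2s : IsSmooth fun x => D.EP x ^ 2 := isSmooth_pow' D.isSmooth_EP 2
  have hP3s : IsSmooth fun x => D.EP x ^ 3 := isSmooth_pow' D.isSmooth_EP 3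
  have hM1s := D.isSmooth_EM
  have hM2s : IsSmooth fun x => D.EM x ^ 2 := isSmooth_pow' D.isSmooth_EM 2
  have hM3s : IsSmooth fun x => D.EM x ^ 3 := isSmooth_pow' D.isSmooth_EM 3
  obtain ⟨C1, hC1, hT1⟩ := exists_two_scale_const hP1s (isSmooth_mix₁_gradAt hFp (D.Yp G))
  obtain ⟨C2, hC2, hT2⟩ := exists_two_scale_const hP2s (isSmooth_mix₂_gradAt hFp (D.Yp G))
  obtain ⟨C3, hC3, hT3⟩ := exists_two_scale_const hP3s (isSmooth_prodBC_gradAt hFp)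
  obtain ⟨C4, hC4, hT4⟩ := exists_two_scale_const hM1s (isSmooth_mix₁_gradAt hFm (D.Ym G))
  obtain ⟨C5, hC5, hT5⟩ := exists_two_scale_const hM2s (isSmooth_mix₂_gradAt hFm (D.Ym G))
  obtain ⟨C6, hC6, hT6⟩ := exists_two_scale_const hM3s (isSmooth_prodBC_gradAt hFm)
  obtain ⟨C7, hC7, hT7⟩ := exists_two_scale_const hP1s (isSmooth_frob_gradAt hFp (D.Yp G))
  obtain ⟨C8, hC8, hT8⟩ := exists_two_scale_const hP2s (isSmooth_halfSqM_gradAt hFp)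
  obtain ⟨C9, hC9, hT9⟩ := exists_two_scale_const hM1s (isSmooth_frob_gradAt hFm (D.Ym G))
  obtain ⟨C10, hC10, hT10⟩ := exists_two_scale_const hM2s (isSmooth_halfSqM_gradAt hFm)
  refine ⟨Kp + Km, C1 + C2 + C3 + C4 + C5 + C6 + C7 + C8 + C9 + C10, by positivity, by positivity, fun m hm => ?_⟩
  have hmpos : (0 : ℝ) < m := by exact_mod_cast hm
  have hKsum : Kp / m + Km / m = (Kp + Km) / m := by rw [add_div]
  refine ⟨fun x => ?_, ?_, ?_⟩
  · have h := D.vortSqM_T_le hβG hβM hβXp hβXm (hRp m hm) (hRm m hm) hGp hGm hVp hVm x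
    rw [show 2 * D.q.eps * βM + Kp / ↑m + Km / ↑m = 2 * D.q.eps * βM + (Kp + Km) / ↑m by rw [← hKsum]; ring] at h
    exact h
  · have h := D.abs_statP_sub_le hβG hβM hβXp hβXm (hRp m hm) (hRm m hm) (hT1 m hm) (hT2 m hm) (hT3 m hm)
      (hT4 m hm) (hT5 m hm) (hT6 m hm)
    rw [hKsum] at h
    have hC : C1 / m + C2 / m + C3 / m + C4 / m + C5 / m + C6 / m ≤ (C1 + C2 + C3 + C4 + C5 + C6 + C7 + C8 + C9 + C10) / m := by
      rw [show C1 / m + C2 / m + C3 / m + C4 / m + C5 / m + C6 / m = (C1 + C2 + C3 + C4 + C5 + C6) / (m : ℝ) by ring]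
      exact div_le_div_of_nonneg_right (by linarith) hmpos.le
    linarith
  · have h := D.abs_statE_sub_le hβG hβM hβXp hβXm (hRp m hm) (hRm m hm) (hT7 m hm) (hT8 m hm) (hT9 m hm) (hT10 m hm)
    rw [hKsum] at h
    have hC : C7 / m + C8 / m + C9 / m + C10 / m ≤ (C1 + C2 + C3 + C4 + C5 + C6 + C7 + C8 + C9 + C10) / m := by
      rw [show C7 / m + C8 / m + C9 / m + C10 / m = (C7 + C8 + C9 + C10) / (m : ℝ) by ring]
      exact div_le_div_of_nonneg_right (by linarith) hmpos.le
    linarith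

end LamData

end Summit.NavierStokesRegularity.FunctionalMining

end
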